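import Summits.HodgeConjecture.HodgeConjecture.Theorems.Ring2AbelianAllAndrePrimitiveLiftRows
import Summits.HodgeConjecture.HodgeConjecture.Theorems.Ring2AbelianAllAndreStandardALieberman
import Literature.AlgebraicGeometry.HodgeTheory.MotivatedClassesTransport
import Literature.AlgebraicGeometry.HodgeTheory.IsoTransport
import HarnessLib

/-!
# Ring 2 · sub-cell AbelianAll (ALL ABELIAN VARIETIES), André axis, part XXI-c — THE REDUCTION TO THE PRIMITIVE LIFT OWES
# NOTHING TO `HC_CM`: granted LIEBERMAN's theorem (`B` for abelian varieties, 1968) the lift in every degree at EVERY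
# point of EVERY compact pencil of abelian varieties is EXACTLY the lift of the monodromy-invariant primitive algebraic
# classes of degrees `4 ≤ 2r ≤ d`; hence (L) ⟺ [CM primitive lift] and (L∀) ⟺ [primitive lift at every point] modulo
# Lieberman only — the precise division of labour "B(fibre) reduces, the total space decides"

HONEST FRAMING (page 1, verbatim): **research route, not a corollary; conditional on HC_CM plus one named
minimal statement.** Cell line: research route conditional on HC_CM; not a corollary; Q11.4-sentence-2
already refuted in dim ≥ 3. Nothing in this file proves a case of the Hodge conjecture for an abelian variety.
`HC_CM` = `Theses.RankFourFaces.CMAbelianHodge` is a BINDER wherever it occurs (one row); `HC_AV` =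
`Theses.PadicSemiregularLift.HodgeAbelianVarieties`; `hL` = the Literature named fact
`HodgeTheory.Lieberman1968_lefschetzInvolution_algebraic_abelianVariety` (Lieberman 1968: `B(A)` in the tree's `⋆_L`-form —
a published THEOREM, carried as a displayed binder, never discharged here), `h₂₁` = `Andre1996.andre1996_cmAnchoredPencil`,
`Verdier` = `Motives.Verdier1976_genericLocalTriviality`; item `Theses.RankFourFaces.CMToAbelian` (stmt-16267) OPEN and not
closed here. Seat `pub-hodge-ring2-ab-andre-2`, gen 13 (sequel of parts XXI-a/b; brief (iii) "B for abelian varieties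
themselves is KNOWN — Lieberman/Kleiman — so identify precisely why that does not suffice").

## Content

Part XXI-a reduces the lift (L)_t to the primitive lifts (Prim)_t(r), `4 ≤ 2r ≤ d`, GRANTED the surjectivity clause of
Kleiman's `A(X_t, κ)` on the FIBRE (needed to know that the primitive components of an algebraic class are algebraic);
part XXI-b discharged that clause at fibres satisfying the Hodge conjecture (CM fibres under `HC_CM`, `E`-power fibres).
Here it is discharged at EVERY fibre by Lieberman's theorem: the fibre is `≅ A.X` for an abelian variety `A`
(`IsCompactAbelianPencil.exists_abelianVariety_fiber`), `B(A.X)` is `hL`, `B ⇒ A` is part XVIII-e's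
`forall_standardConjectureA_abelianVariety_of_lieberman`, and `A(X, η)` transports along isomorphisms (§1, new API:
`standardConjectureA_map_of_iso`).

* §1 `standardConjectureA_map_of_iso` (`A(X, η) ⟹ A(X', e^*η)` for `e : X' ≅ X`). §2
  **`standardConjectureA_fiberOver_of_lieberman`** (`A(X_t, κ)` for every polarisation class of every fibre, mod `hL`).
* §3 **`forall_comap_le_sup_iff_primitiveLift_of_lieberman`**: at EVERY point `t` of EVERY compact pencil of abelian
  varieties, `(∀ p, (L)_t(p)) ⟺ (∀ r, 4 ≤ 2r ≤ d → (Prim)_t(r))`, granted `hL` only — no `HC_CM`, no CM point, no Hodge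
  hypothesis.
* §4 node level WITHOUT `HC_CM` in the reduction: **`cmFibreAlgebraicLift_iff_cmPrimitiveLift_of_lieberman`**
  ((L) ⟺ [CM primitive lift] mod `hL`; part XXI-b had `⟸` under `HC_CM`), **`algebraicFixedPart_iff_primitiveLiftEverywhere_of_lieberman`**
  ((L∀) ⟺ [primitive lift at every point] mod `hL`), `compactAbelianPencilVHC_of_lieberman_of_primitiveLiftEverywhere`
  ((2) from it), the cell row `HC_AV_of_HC_CM_of_lieberman_of_cmPrimitiveLift` (`h₂₁`, `HC_CM`, `hL` binders — `HC_CM` now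
  enters ONLY through André's transport, not through the reduction), the exactness
  **`HC_AV_iff_HC_CM_and_primitiveLiftEverywhere_of_verdier_of_lieberman`** (mod [h₂₁, Verdier, hL]) and the on-path
  `primitiveLiftEverywhere_of_hodgeConjecture` (fact-free); §5 `primitiveLift_of_numerical_of_lieberman` ((Num_t) in all
  bidegrees ⟹ (Prim)_t at every point, mod `hL`). The brackets are display-only `local notation3`
  (`CMPrimitiveLift[]` as in part XXI-b, `PrimitiveLiftEverywhere[]`); NO definition is made.

WHY "B IS KNOWN FOR ABELIAN VARIETIES" DOES NOT SUFFICE, PRECISELY (brief (iii)): Lieberman's `B(X_t)` does real work —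
it splits every invariant algebraic class of the fibre into algebraic Lefschetz components and lets the coprimitive ones be
inherited from lower degree — and then stops: the lift of a PRIMITIVE invariant algebraic class of the fibre asks for a
cycle on the non-abelian total space `𝒳`, about which `B(X_t)` says nothing (`B(𝒳)` / `A(𝒳)` would: seat ab-andre-1's
A-ladder, part XVIII-e). HONEST STATUS: nothing here is fact-free progress on `HC_AV`; `hL` is a named fact (debt unchanged:
it was already load-bearing in parts XII, XVIII-e); under `HC_CM` nothing new is equivalent or minimal beyond part XXI-b.

EDGE LABELS (RING2-MAP §AbelianAll gen 13): §1 K; §2–§4 K[hL]; the HC_AV row K[h₂₁, HC_CM, hL]; the iff K[h₂₁, Verdier, hL];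
on-path K. References: Lieberman1968 (main theorem); Kleiman1968AlgebraicCycles (§3); Grothendieck1968 (§3 p. 196);
Andre1996Motifs (§1.1, §5.1, Lemme 6.3.1, §6.3); Milne2020HodgeClassesAV (Prop. 1); Abdulali1994FamiliesAV ((1.1), p. 1122);
Verdier1976 (Cor. 5.1); GrothendieckTopology1969 (§1).
-/

noncomputable section

set_option linter.dupNamespace false

namespace Summit.HodgeConjecture.HodgeConjecture.Ring2.AbelianAll

open CategoryTheory AlgebraicGeometry
open Literature.AlgebraicGeometry Literature.AlgebraicGeometry.Motives
open Literature.AlgebraicGeometry.HodgeTheory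
open Literature.AlgebraicTopology.SingularHomology (singularCohomology cupProduct)
open Literature.Geometry.Kaehler (lefschetzOperator lefschetzPow lefschetzPow_map HasHardLefschetzProperty)
open Literature.AlgebraicGeometry.Deligne1982 (cmLocus)
open Literature.AlgebraicGeometry.Andre1996 (andre1996_cmAnchoredPencil)
open Summit.HodgeConjecture.HodgeConjecture.Theses
open Summit.HodgeConjecture.HodgeConjecture.Ring2.Deform (CompactAbelianPencilVHC)

/-! ## §1 `A(X, η)` transports along isomorphisms -/

section Iso

variable {n : ℕ} {X X' : SchemeOver ℂ}

/-- **`A(X, η)` is invariant under isomorphism**: for `e : X' ≅ X`, `A(X, η) ⟹ A(X', e^*η)` — pull-backs along `e`, `e⁻¹`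
exchange algebraic and supported classes (`mem_supportedClasses_map_iff_of_iso`), intertwine the Lefschetz iterates
(`lefschetzPow_map`) and transport hard Lefschetz (`HasHardLefschetzProperty.map_of_iso`).
[cite: Grothendieck1968, §3 p. 196 (A(X))] [cite: GrothendieckTopology1969, §1] -/
theorem standardConjectureA_map_of_iso (e : X' ≅ X) {η : complexBetti X 2} (hA : StandardConjectureA n X η) :
    StandardConjectureA n X' (complexBetti.map e.hom 2 η) := by
  refine ⟨hA.1.map_of_iso e, fun p r q hpr hq ↦ ?_⟩
  have hB := hA.2 p r q hpr hq
  have hnat : ∀ x : complexBetti X (2 * p),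
      lefschetzPow (complexBetti.map e.hom 2 η) r (2 * p) (complexBetti.map e.hom (2 * p) x) =
        complexBetti.map e.hom (2 * p + 2 * r) (lefschetzPow η r (2 * p) x) :=
    fun x ↦ (lefschetzPow_map (AlgPoints.mapContinuous (L := ℂ) e.hom) η r (2 * p) x).symm
  refine ⟨fun x' hx' ↦ ?_, fun x₁ _ x₂ _ h ↦ ?_, fun y' hy' ↦ ?_⟩
  · have hx : complexBetti.map e.inv (2 * p) x' ∈ algebraicClasses X p :=
      (mem_algebraicClasses_map_iff_of_iso e.symm).2 hx'
    rw [← e.complexBetti_map_hom_map_inv (2 * p) x', hnat]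
    exact mem_supportedClasses_map_of_iso e (hB.1 hx)
  · exact ((hA.1.map_of_iso e) r (2 * p) hpr).1 h
  · have hy : complexBetti.map e.inv (2 * p + 2 * r) y' ∈ supportedClasses X (2 * p + 2 * r) q :=
      (mem_supportedClasses_map_iff_of_iso e.symm).2 hy'
    obtain ⟨x, hx, hxy⟩ := hB.2.2 hy
    refine ⟨complexBetti.map e.hom (2 * p) x, (mem_algebraicClasses_map_iff_of_iso e).2 hx, ?_⟩
    rw [hnat, hxy, e.complexBetti_map_hom_map_inv]

end Iso

variable {𝒳 S : SchemeOver ℂ}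

/-! ## §2 Lieberman's theorem gives `A(X_t, κ)` on every fibre of a compact abelian pencil -/

/-- **`A(X_t, κ)` at EVERY fibre of a compact pencil of abelian varieties, for every polarisation class `κ`, granted
Lieberman's theorem** (the fibre is `≅ A.X` for an abelian variety `A` of dimension `d`; `B(A.X)` is Lieberman's named
fact in the tree's `⋆_L`-form, `B ⇒ A` is part XVIII-e's `forall_standardConjectureA_abelianVariety_of_lieberman`; §1
transports). [cite: Lieberman1968, main theorem] [cite: Grothendieck1968, §3 p. 196 (B(X) ⇒ A(X))] -/
theorem standardConjectureA_fiberOver_of_lieberman (hL : Lieberman1968_lefschetzInvolution_algebraic_abelianVariety)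
    {d : ℕ} {f : 𝒳 ⟶ S} (hf : IsCompactAbelianPencil f d) (t : ComplexPoints S)
    {κ : complexBetti (fiberOver f t) 2} (hκ : IsPolarizationClass d (fiberOver f t) κ) :
    StandardConjectureA d (fiberOver f t) κ := by
  obtain ⟨A, ⟨e⟩⟩ := hf.exists_abelianVariety_fiber t
  have hdim : A.dim = d := Andre1996.compactPencil_dim_eq_of_iso hf e
  subst hdim
  have hκA : IsPolarizationClass A.dim A.X (complexBetti.map e.hom 2 κ) :=
    IsPolarizationClass.map_of_iso (hf.isSmoothProjective_fiberOver t) (AbelianVariety.isSmoothProjective_holds (A := A)) e hκ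
  have hAA := forall_standardConjectureA_abelianVariety_of_lieberman hL A _ hκA
  have h := standardConjectureA_map_of_iso e.symm hAA
  rwa [Iso.symm_hom, e.complexBetti_map_inv_map_hom] at h

/-! ## §3 At EVERY point: the lift in every degree ⟺ the primitive lifts, modulo Lieberman only -/

/-- **(∀ p, (L)_t(p)) ⟺ (∀ r, 4 ≤ 2r ≤ d → (Prim)_t(r)) at EVERY point of EVERY compact pencil of abelian varieties, granted
Lieberman's theorem only** — no `HC_CM`, no CM point, no Hodge hypothesis (part XXI-a's
`forall_comap_le_sup_iff_primitiveLift_of_standardConjectureA` with `A(X_t, κ)` from §2). This is the precise division of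
labour of brief (iii): Lieberman's `B` for the abelian FIBRE carries the reduction to the primitive invariant classes;
the primitive lift itself is a statement about cycles on the NON-abelian total space.
[cite: Lieberman1968, main theorem] [cite: Kleiman1968AlgebraicCycles, §3] [cite: Milne2020HodgeClassesAV, Prop. 1 (p. 7)] -/
theorem forall_comap_le_sup_iff_primitiveLift_of_lieberman
    (hL : Lieberman1968_lefschetzInvolution_algebraic_abelianVariety) {d : ℕ} {f : 𝒳 ⟶ S}
    (hf : IsCompactAbelianPencil f d) (t : ComplexPoints S) {K : complexBetti 𝒳 2}
    (hKalg : K ∈ algebraicClasses 𝒳 1)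
    (hKs : ∀ s : ComplexPoints S, IsPolarizationClass d (fiberOver f s) (complexBetti.map (fiberι f s) 2 K)) :
    (∀ p : ℕ, (algebraicClasses (fiberOver f t) p).comap (complexBetti.map (fiberι f t) (2 * p)).hom ≤
      algebraicClasses 𝒳 p ⊔ LinearMap.ker (complexBetti.map (fiberι f t) (2 * p)).hom) ↔
    ∀ r, 2 ≤ r → 2 * r ≤ d → ∀ ξ ∈ algebraicClasses (fiberOver f t) r,
      ξ ∈ primitiveClasses (complexBetti.map (fiberι f t) 2 K) d (2 * r) →
      ξ ∈ LinearMap.range (complexBetti.map (fiberι f t) (2 * r)).hom →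
      ξ ∈ (algebraicClasses 𝒳 r).map (complexBetti.map (fiberι f t) (2 * r)).hom :=
  forall_comap_le_sup_iff_primitiveLift_of_standardConjectureA hf t hKalg (fun s ↦ (hKs s).hasHardLefschetz) (hKs t)
    (standardConjectureA_fiberOver_of_lieberman hL hf t (hKs t))

/-- Display-only shape (as in part XXI-b; no `def`): the CM PRIMITIVE LIFT. -/
local notation3 (prettyPrint := false) "CMPrimitiveLift[]" =>
  ∀ ⦃d : ℕ⦄ ⦃𝒳 S : SchemeOver ℂ⦄ (f : 𝒳 ⟶ S) (_ : IsCompactAbelianPencil f d) (t : ComplexPoints S),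
    t ∈ cmLocus f d → ∀ (K : complexBetti 𝒳 2), K ∈ algebraicClasses 𝒳 1 →
    (∀ s : ComplexPoints S, IsPolarizationClass d (fiberOver f s) (complexBetti.map (fiberι f s) 2 K)) →
    ∀ r, 2 ≤ r → 2 * r ≤ d → ∀ ξ ∈ algebraicClasses (fiberOver f t) r,
      ξ ∈ primitiveClasses (complexBetti.map (fiberι f t) 2 K) d (2 * r) →
      ξ ∈ LinearMap.range (complexBetti.map (fiberι f t) (2 * r)).hom →
      ξ ∈ (algebraicClasses 𝒳 r).map (complexBetti.map (fiberι f t) (2 * r)).hom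

/-- Display-only shape (no `def`): the PRIMITIVE LIFT AT EVERY POINT of every compact pencil of abelian varieties. -/
local notation3 (prettyPrint := false) "PrimitiveLiftEverywhere[]" =>
  ∀ ⦃d : ℕ⦄ ⦃𝒳 S : SchemeOver ℂ⦄ (f : 𝒳 ⟶ S) (_ : IsCompactAbelianPencil f d) (t : ComplexPoints S)
    (K : complexBetti 𝒳 2), K ∈ algebraicClasses 𝒳 1 →
    (∀ s : ComplexPoints S, IsPolarizationClass d (fiberOver f s) (complexBetti.map (fiberι f s) 2 K)) →
    ∀ r, 2 ≤ r → 2 * r ≤ d → ∀ ξ ∈ algebraicClasses (fiberOver f t) r,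
      ξ ∈ primitiveClasses (complexBetti.map (fiberι f t) 2 K) d (2 * r) →
      ξ ∈ LinearMap.range (complexBetti.map (fiberι f t) (2 * r)).hom →
      ξ ∈ (algebraicClasses 𝒳 r).map (complexBetti.map (fiberι f t) (2 * r)).hom

/-! ## §4 Node level WITHOUT `HC_CM`: (L) ⟺ [CM primitive lift] and (L∀) ⟺ [primitive lift everywhere], modulo Lieberman -/

/-- **(L) ⟺ [CM primitive lift], granted Lieberman's theorem only** (part XXI-b had `⟸` under `HC_CM`; here `HC_CM` is
replaced by the 1968 theorem `B(A)` for the CM fibre — a Literature named fact carried as the binder `hL`).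
[cite: Lieberman1968, main theorem] [cite: Andre1996Motifs, §5.1 (p. 25) and §6.3 (p. 33)] -/
theorem cmFibreAlgebraicLift_iff_cmPrimitiveLift_of_lieberman
    (hL : Lieberman1968_lefschetzInvolution_algebraic_abelianVariety) : CMFibreAlgebraicLift ↔ CMPrimitiveLift[] := by
  refine ⟨cmPrimitiveLift_of_cmFibreAlgebraicLift, fun hPrim ↦ ?_⟩
  refine cmFibreAlgebraicLift_iff_comap_le_sup.2 fun d 𝒳 S f hf p t ht ↦ ?_
  obtain ⟨K, hKalg, -, hKs⟩ := exists_algebraic_globalPolarization hf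
  exact (forall_comap_le_sup_iff_primitiveLift_of_lieberman hL hf t hKalg hKs).2 (hPrim f hf t ht K hKalg hKs) p

/-- **(L∀) ⟺ [primitive lift at every point], granted Lieberman's theorem only**: the algebraic fixed part of the André
axis (node `AlgebraicFixedPart`, lattice form `(j_s^*)⁻¹N^p(𝒳_s) = N^p(𝒳) ⊔ ker j_s^*` at every point, part XVII-b) IS the
lift of the monodromy-invariant primitive algebraic classes of degrees `4 ≤ 2r ≤ d` at every fibre.
[cite: Lieberman1968, main theorem] [cite: Milne2020HodgeClassesAV, Prop. 1 (p. 7)] [cite: Andre1996Motifs, Remarque 2 (p. 33)] -/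
theorem algebraicFixedPart_iff_primitiveLiftEverywhere_of_lieberman
    (hL : Lieberman1968_lefschetzInvolution_algebraic_abelianVariety) : AlgebraicFixedPart ↔ PrimitiveLiftEverywhere[] := by
  rw [algebraicFixedPart_iff_comap_eq_sup]
  refine ⟨fun h d 𝒳 S f hf t K _ _ r _ _ ξ hξ _ hrange ↦
      mem_map_algebraicClasses_of_comap_le_sup hf t (le_of_eq (h f hf r t)) hξ hrange,
    fun hPrim d 𝒳 S f hf p s ↦ ?_⟩
  obtain ⟨K, hKalg, -, hKs⟩ := exists_algebraic_globalPolarization hf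
  exact le_antisymm
    ((forall_comap_le_sup_iff_primitiveLift_of_lieberman hL hf s hKalg hKs).2 (hPrim f hf s K hKalg hKs) p)
    (algebraicClasses_sup_ker_le_comap hf p s)

/-- **[primitive lift everywhere] ⟹ Abdulali's (1.1)_f on every compact pencil of abelian varieties, granted Lieberman**
(through (L∀) and part XVII-b's lattice identities). [cite: Abdulali1994FamiliesAV, (1.1) and p. 1122] [cite: Lieberman1968, main theorem] -/
theorem compactAbelianPencilVHC_of_lieberman_of_primitiveLiftEverywhere
    (hL : Lieberman1968_lefschetzInvolution_algebraic_abelianVariety) (hPrim : PrimitiveLiftEverywhere[]) :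
    CompactAbelianPencilVHC :=
  compactAbelianPencilVHC_of_algebraicFixedPart ((algebraicFixedPart_iff_primitiveLiftEverywhere_of_lieberman hL).2 hPrim)

/-- **THE CELL ROW WITHOUT `HC_CM` IN THE REDUCTION: `h₂₁ → HC_CM → [CM primitive lift] → HC_AV`, the reduction step
now granted Lieberman instead of `HC_CM`** (`HC_CM` still enters, as a BINDER, through André's transport: it makes the CM
fibre's Hodge classes algebraic). Same conclusion as part XXI-b's `HC_AV_of_HC_CM_of_cmPrimitiveLift`; recorded to show
that the REDUCTION owes nothing to `HC_CM`. research route, not a corollary; conditional on HC_CM plus one named minimal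
statement. [cite: Andre1996Motifs, Lemme 6.3.1 (p. 31) and §6.3 (p. 33)] [cite: Lieberman1968, main theorem] -/
theorem HC_AV_of_HC_CM_of_lieberman_of_cmPrimitiveLift (h₂₁ : andre1996_cmAnchoredPencil)
    (hCM : RankFourFaces.CMAbelianHodge) (hL : Lieberman1968_lefschetzInvolution_algebraic_abelianVariety)
    (hPrim : CMPrimitiveLift[]) : PadicSemiregularLift.HodgeAbelianVarieties :=
  HC_AV_of_HC_CM_and_cmFibreAlgebraicLift h₂₁ hCM ((cmFibreAlgebraicLift_iff_cmPrimitiveLift_of_lieberman hL).2 hPrim)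

/-- **EXACTNESS of (L∀) through the primitive lift, modulo [h₂₁, Verdier, Lieberman]:
`HC_AV ⟺ HC_CM ∧ [primitive lift at every point]`** (part XX-a's `HC_AV_iff_HC_CM_and_algebraicFixedPart_of_verdier`
read through §4). [cite: Andre1996Motifs, Lemme 6.3.1 (p. 31)] [cite: Verdier1976, Cor. (5.1)] [cite: Lieberman1968, main theorem] -/
theorem HC_AV_iff_HC_CM_and_primitiveLiftEverywhere_of_verdier_of_lieberman (h₂₁ : andre1996_cmAnchoredPencil)
    (hGT : Verdier1976_genericLocalTriviality) (hL : Lieberman1968_lefschetzInvolution_algebraic_abelianVariety) :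
    PadicSemiregularLift.HodgeAbelianVarieties ↔ (RankFourFaces.CMAbelianHodge ∧ PrimitiveLiftEverywhere[]) := by
  rw [HC_AV_iff_HC_CM_and_algebraicFixedPart_of_verdier h₂₁ hGT, algebraicFixedPart_iff_primitiveLiftEverywhere_of_lieberman hL]

/-- **ON-PATH: `HodgeConjecture ⟹ [primitive lift at every point]`** (fact-free; part VI's algebraic fixed part).
[cite: Andre1996Motifs, §6.3 (p. 33)] -/
theorem primitiveLiftEverywhere_of_hodgeConjecture (h : _root_.HodgeConjecture) : PrimitiveLiftEverywhere[] := by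
  intro d 𝒳 S f hf t K _ _ r _ _ ξ hξ _ hrange
  exact mem_map_algebraicClasses_of_comap_le_sup hf t
    (le_of_eq (algebraicFixedPart_iff_comap_eq_sup.1 (algebraicFixedPart_of_hodgeConjecture h) f hf r t)) hξ hrange

/-! ## §5 (Num_t) ⟹ (Prim)_t at EVERY point, modulo Lieberman (no Hodge hypothesis on the fibre) -/

/-- **At every point of every compact pencil of abelian varieties, granted Lieberman: [(Num_t)(p,q) for all `p + q = d`] ⟹
[(Prim)_t(r) for all `r`]** ((Perf_t) from `B(X_t)`, part XVIII-e; the lift of part XVIII-a; then the primitive lift is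
contained in the lift). The converse needs the Hodge conjecture of the fibre (part XXI-b §5).
[cite: Lieberman1968, main theorem] [cite: Kleiman1968AlgebraicCycles, §3 (D(X))] [cite: Milne2020HodgeClassesAV, Prop. 1 (p. 7)] -/
theorem primitiveLift_of_numerical_of_lieberman (hL : Lieberman1968_lefschetzInvolution_algebraic_abelianVariety)
    {d : ℕ} {f : 𝒳 ⟶ S} (hf : IsCompactAbelianPencil f d) (t : ComplexPoints S) (K : complexBetti 𝒳 2)
    (hNum : ∀ (p q : ℕ) (hpq : p + q = d), ∀ b ∈ algebraicClasses (fiberOver f t) q,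
      (∀ a ∈ algebraicClasses 𝒳 p,
        cupProduct (show 2 * p + 2 * (q + 1) = 2 * (d + 1) by omega) a (fiberGysin hf t q b) = 0) →
        fiberGysin hf t q b = 0)
    (r : ℕ) {ξ : complexBetti (fiberOver f t) (2 * r)} (hξ : ξ ∈ algebraicClasses (fiberOver f t) r)
    (_hprim : ξ ∈ primitiveClasses (complexBetti.map (fiberι f t) 2 K) d (2 * r))
    (hrange : ξ ∈ LinearMap.range (complexBetti.map (fiberι f t) (2 * r)).hom) :
    ξ ∈ (algebraicClasses 𝒳 r).map (complexBetti.map (fiberι f t) (2 * r)).hom := by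
  rcases le_or_gt r d with hr | hr
  · obtain ⟨h₁, h₂⟩ := nondegenerate_fiberOver_of_lieberman hL hf t (show r + (d - r) = d by omega)
    exact mem_map_algebraicClasses_of_comap_le_sup hf t
      (comap_le_sup_of_nondegenerate_of_numerical hf t (show r + (d - r) = d by omega) h₁ h₂ (hNum r (d - r) (by omega)))
      hξ hrange
  · exact mem_map_algebraicClasses_of_comap_le_sup hf t (comap_le_sup_of_relDim_lt hf t hr) hξ hrange

end Summit.HodgeConjecture.HodgeConjecture.Ring2.AbelianAll

end
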